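import Summits.BirchSwinnertonDyer.BirchSwinnertonDyer.Theses.SignedLowerHalves
import Summits.BirchSwinnertonDyer.BirchSwinnertonDyer.Theorems.SignedLowerHalvesKobayashiMainConjectureSmallImageTeichSpanHeckeEigen
import HarnessLib

/-!
# Route `SignedLowerHalves` (K3 rev 17), child item stmt-BirchSwinnertonDyer-23117 `SmallImageOneSignUnitContent` BY NAME
# from the EXACT hinge «B⁰ modulo the eigen-relators of the newform, at the conductor level, per pair»
# (cell `bsd-ssimc`, LEAD seat `bsd-line-slh-p3` gen 11; THEOREMS ONLY; `--supports` item 23117 — a DOOR, not a closure)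

The split of crux 4 (K3 rev 17) made the one-sign μ-rider at `p ≥ 5` the route decl `SmallImageOneSignUnitContent` (= line `birth_acns`
v13 `stub_muOneSign_ns_ge5` VERBATIM).  This file states the third cut of its hinge (this seat's `…SmallImageTeichSpanHeckeEigen`, p659743)
AGAINST THE ROUTE DECL: `SmallImageOneSignUnitContent` follows from «for every pair `(E, p)` of the class and its conductor-level newform
`f`, `TeichSpanGenMod N_E p (heckeEigenRelators f p)`» — the Teichmüller packets span the `f`-isotypic part of `H₁(X₀(N_E);𝔽_p)⁺`
(all of `𝔪_f` divided out; under mod-`p` multiplicity one EQUIVALENT to the item).  Also recorded: the item from g10's second-cut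
hypothesis and from CONJ B⁰ at the conductor levels (both stronger hypotheses).  HONEST SCOPE: the hypothesis is OPEN class-wide
(one-signed Perrin-Riou on the population); item 23117 is NOT closed by this file; no summit statement / BSD case is proved.

References: [MazurTateTeitelbaum1986Invent] §I.4 (4.2), §I.10 (10.1); [Manin1972] Prop. 1.4; [PollackWeston2011] Thm. 4.1 / Rem. 4.2.
-/

-- D-0017: single-problem summit, the namespace repeats the problem name by design.
set_option linter.dupNamespace false
set_option autoImplicit false

noncomputable section

open scoped Classical MatrixGroups ModularForm
open CongruenceSubgroup Literature.NumberTheory.EllipticCurves.Rank1Residual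

namespace Summit.BirchSwinnertonDyer.BirchSwinnertonDyer.Theorems.SmallImageOneSignDoor

open Literature.NumberTheory.EllipticCurves Literature.NumberTheory.EllipticCurves.ModularForms
  Summit.BirchSwinnertonDyer.BirchSwinnertonDyer.Cruxes.AnalyticMuZeroX9.TeichSpan
  Summit.BirchSwinnertonDyer.BirchSwinnertonDyer.Theorems.SmallImageTeichSpanHecke
  Summit.BirchSwinnertonDyer.BirchSwinnertonDyer.Theorems.SmallImageTeichSpanHeckeEigen

/-- **Item 23117 `SmallImageOneSignUnitContent` ⟸ the EXACT hinge per pair**: if for every pair `(E, p)` of the class (X7, non-CM,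
good supersingular `p ≥ 5`, `a_p = 0`, `ρ̄_{E,p}` not surjective) and its conductor-level newform `f` the Teichmüller packets generate
`Γ₀(N_E)` modulo the B⁰ generators, the eigen-relators `heckeEigenRelators f p` and commutators (`TeichSpanGenMod N_E p (heckeEigenRelators f p)`),
then the route decl holds. (`muOneSign_ns_ge5_of_teichSpanGenMod_heckeEigenRelators_conductor`, statement = the decl verbatim.)
[cite: MazurTateTeitelbaum1986Invent, §I.4 (4.2), §I.10 (10.1)] [cite: PollackWeston2011, Thm. 4.1 (1)] -/
theorem smallImageOneSignUnitContent_of_teichSpanGenMod_heckeEigenRelators_conductor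
    (hB : ∀ (W : WeierstrassCurve ℚ) [W.IsElliptic] [W.IsGloballyMinimal] (p : ℕ) [Fact p.Prime], 5 ≤ p →
      ClassX7 W p → ¬ W.HasCM → W.frobeniusTrace p = 0 → ¬ Surj W p →
      ∀ [NeZero (W.conductorNorm ℤ)] (f : CuspForm (Gamma0 (W.conductorNorm ℤ)) 2), IsNewformOf W f →
        TeichSpanGenMod (W.conductorNorm ℤ) p (heckeEigenRelators f p)) :
    Summit.BirchSwinnertonDyer.BirchSwinnertonDyer.Theses.SignedLowerHalves.SmallImageOneSignUnitContent := by
  unfold Summit.BirchSwinnertonDyer.BirchSwinnertonDyer.Theses.SignedLowerHalves.SmallImageOneSignUnitContent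
  exact muOneSign_ns_ge5_of_teichSpanGenMod_heckeEigenRelators_conductor hB

/-- **Item 23117 ⟸ g10's second-cut hypothesis** («B⁰ modulo `heckeRelators f p` at the conductor level, per pair» — the `K`-dihedral
residually supersingular part), via the third cut. [cite: MazurTateTeitelbaum1986Invent, §I.4 (4.2), §I.10 (10.1)] -/
theorem smallImageOneSignUnitContent_of_teichSpanGenMod_heckeRelators_conductor
    (hB : ∀ (W : WeierstrassCurve ℚ) [W.IsElliptic] [W.IsGloballyMinimal] (p : ℕ) [Fact p.Prime], 5 ≤ p →
      ClassX7 W p → ¬ W.HasCM → W.frobeniusTrace p = 0 → ¬ Surj W p →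
      ∀ [NeZero (W.conductorNorm ℤ)] (f : CuspForm (Gamma0 (W.conductorNorm ℤ)) 2), IsNewformOf W f →
        TeichSpanGenMod (W.conductorNorm ℤ) p (heckeRelators f p)) :
    Summit.BirchSwinnertonDyer.BirchSwinnertonDyer.Theses.SignedLowerHalves.SmallImageOneSignUnitContent :=
  smallImageOneSignUnitContent_of_teichSpanGenMod_heckeEigenRelators_conductor
    (teichSpanGenMod_heckeEigenRelators_conductor_of_heckeRelators_conductor hB)

/-- **Item 23117 ⟸ CONJ B⁰ at the conductor levels of the class** (`TeichSpanGen N_E p` per pair — the strongest of the hypotheses,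
cell bsd-f3-mu's conjecture restricted to the levels that occur), via `teichSpanGenMod_of_teichSpanGen`.
[cite: MazurTateTeitelbaum1986Invent, §I.10 (10.1)] [cite: Manin1972, Prop. 1.4] -/
theorem smallImageOneSignUnitContent_of_teichSpanGen_conductor
    (hB : ∀ (W : WeierstrassCurve ℚ) [W.IsElliptic] [W.IsGloballyMinimal] (p : ℕ) [Fact p.Prime], 5 ≤ p →
      ClassX7 W p → ¬ W.HasCM → W.frobeniusTrace p = 0 → ¬ Surj W p →
      ∀ [NeZero (W.conductorNorm ℤ)], TeichSpanGen (W.conductorNorm ℤ) p) :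
    Summit.BirchSwinnertonDyer.BirchSwinnertonDyer.Theses.SignedLowerHalves.SmallImageOneSignUnitContent :=
  smallImageOneSignUnitContent_of_teichSpanGenMod_heckeEigenRelators_conductor
    fun W _ _ p _ hp5 hX hCM hap hs _ _ _ ↦ teichSpanGenMod_of_teichSpanGen _ (hB W p hp5 hX hCM hap hs)

end Summit.BirchSwinnertonDyer.BirchSwinnertonDyer.Theorems.SmallImageOneSignDoor

end
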